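/-
Solo-blind KontsevichZagierPeriods, session s19 — ALL DEPTHS at the base point y = -1:
the interval rule, the pigeonhole vanishing (T1) and the interlacing condition (8.12.5).
-/
import Summits.KontsevichZagierPeriods.KontsevichZagierPeriods.Theorems.SoloBlindDepthThree

/-!
# Interval rule, pigeonhole vanishing and interlacing for chain products

Companion to `SoloBlindDepthThree` (chain rule `listProd_apply`).  In the graded Lie algebra of the
mixed Tate structure of a WORD OF BLOCKS (multiple polylogarithm at `-1`, blocks = classical
polylogarithm structures, boundaries `β₀ = 0 < β₁ < ⋯ < β_{k-1}`), every homogeneous element of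
degree `d` satisfies the INTERVAL RULE: its entry `(i, i+d)` vanishes unless `[i, i+d)` contains a
boundary (inside a block the algebra is split with zero off-corner entries).  We take the rule as a
hypothesis (`IntervalRule B d Y`) and prove, purely combinatorially:

* `listProd_eq_zero_of_card_lt` **(T1)**: a product of `k` homogeneous interval-rule matrices, in
  any order, is ZERO when there are fewer than `k` boundaries — so depth-`k` bracket elements have
  zero corner on every structure with fewer than `k` blocks (`lie_eq_zero_of_card_lt_two`,
  `lie3_eq_zero_of_card_lt_three`);
* `card_filter_lt_chainPoint_eq` **(8.12.5)**: if a chain of `k` interval-rule factors is nonzero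
  and there are exactly `k` boundaries, then exactly `l` boundaries lie strictly below the `l`-th
  chain point, for every `l` — the chain points and the boundaries INTERLACE.  This is the
  compatibility condition from which the Lyndon-order triangularity (T2) of the accompanying notes
  is read off.

Everything is over an arbitrary commutative ring and uses only `Finset` counting.
-/

namespace Summit.KontsevichZagierPeriods.KontsevichZagierPeriods.Theorems

namespace SoloBlind

namespace AllDepths

open Matrix PolylogLadder DepthTwo DepthThree

variable {K : Type*} [CommRing K] {n : ℕ}

local notation "𝕄" => Matrix (Fin (n + 2)) (Fin (n + 2)) K

/-- The INTERVAL RULE with boundary set `B` for a matrix `Y` regarded as homogeneous of degree `d`: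
an on-degree entry `Y i j` (`j = i + d`) can be nonzero only if the half-open interval `[i, j)`
contains a boundary `β ∈ B`.  (Lemma 8.12.1 of the accompanying notes: elements of the graded Lie
algebra of a word of blocks satisfy it with `B` = the set of block boundaries.) -/
def IntervalRule (B : Finset ℕ) (d : ℕ) (Y : 𝕄) : Prop :=
  ∀ i j : Fin (n + 2), (j : ℕ) = i + d → Y i j ≠ 0 → ∃ β ∈ B, (i : ℕ) ≤ β ∧ β < j

/-- The zero matrix satisfies every interval rule. -/
theorem IntervalRule.zero (B : Finset ℕ) (d : ℕ) : IntervalRule B d (0 : 𝕄) :=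
  fun _ _ _ h => (h rfl).elim

/-- The interval rule is stable under addition. -/
theorem IntervalRule.add {B : Finset ℕ} {d : ℕ} {Y Z : 𝕄} (hY : IntervalRule B d Y)
    (hZ : IntervalRule B d Z) : IntervalRule B d (Y + Z) := by
  intro i j hj h
  rw [Matrix.add_apply] at h
  by_cases hy : Y i j = 0
  · rw [hy, zero_add] at h
    exact hZ i j hj h
  · exact hY i j hj hy

/-- The interval rule is stable under scalar multiplication. -/
theorem IntervalRule.smul {B : Finset ℕ} {d : ℕ} {Y : 𝕄} (c : K) (hY : IntervalRule B d Y) :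
    IntervalRule B d (c • Y) := by
  intro i j hj h
  rw [Matrix.smul_apply, smul_eq_mul] at h
  by_cases hy : Y i j = 0
  · rw [hy, mul_zero] at h
    exact (h rfl).elim
  · exact hY i j hj hy

/-- The interval rule is stable under negation. -/
theorem IntervalRule.neg {B : Finset ℕ} {d : ℕ} {Y : 𝕄} (hY : IntervalRule B d Y) :
    IntervalRule B d (-Y) := by
  intro i j hj h
  rw [Matrix.neg_apply, ne_eq, neg_eq_zero] at h
  exact hY i j hj h

/-- Enlarging the boundary set preserves the interval rule. -/
theorem IntervalRule.mono {B B' : Finset ℕ} (hBB' : B ⊆ B') {d : ℕ} {Y : 𝕄}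
    (hY : IntervalRule B d Y) : IntervalRule B' d Y := by
  intro i j hj h
  obtain ⟨β, hβ, h1, h2⟩ := hY i j hj h
  exact ⟨β, hBB' hβ, h1, h2⟩

/-- A matrix supported on a single entry `(p, q)` satisfies the interval rule as soon as `[p, q)`
contains a boundary. -/
theorem IntervalRule.smul_E (B : Finset ℕ) (d : ℕ) (p q : Fin (n + 2)) (c : K)
    (hβ : ∃ β ∈ B, (p : ℕ) ≤ β ∧ β < q) : IntervalRule B d (c • E K p q : 𝕄) := by
  intro i j _ h
  rw [Matrix.smul_apply, E_apply, smul_eq_mul] at h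
  by_cases hij : i = p ∧ j = q
  · obtain ⟨rfl, rfl⟩ := hij
    exact hβ
  · rw [if_neg hij, mul_zero] at h
    exact (h rfl).elim

/-- PIGEONHOLE CORE of (T1): a chain product of interval-rule matrices starting at row `i` vanishes
as soon as there are fewer boundaries `≥ i` than factors.  Each nonzero head entry consumes a
boundary inside its own interval, which is then unavailable to the tail. -/
theorem chain_eq_zero_of_card_filter_lt (B : Finset ℕ) (L : List (ℕ × 𝕄))
    (hL : ∀ p ∈ L, IntervalRule B p.1 p.2) (i : Fin (n + 2))
    (hcard : (B.filter (fun β => (i : ℕ) ≤ β)).card < L.length) : chain L i = 0 := by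
  induction L generalizing i with
  | nil => simp at hcard
  | cons p t ih =>
    obtain ⟨d, Y⟩ := p
    rw [chain_cons]
    split_ifs with h
    · by_cases hY : Y i ⟨(i : ℕ) + d, h⟩ = 0
      · rw [hY, zero_mul]
      · obtain ⟨β, hβB, hiβ, hβj⟩ :=
          hL (d, Y) List.mem_cons_self i ⟨(i : ℕ) + d, h⟩ rfl hY
        have hβj' : β < (i : ℕ) + d := by simpa using hβj
        have hmem : β ∈ B.filter (fun γ => (i : ℕ) ≤ γ) := Finset.mem_filter.mpr ⟨hβB, hiβ⟩
        have hsub : B.filter (fun γ => (i : ℕ) + d ≤ γ) ⊆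
            (B.filter (fun γ => (i : ℕ) ≤ γ)).erase β := by
          intro γ hγ
          rw [Finset.mem_filter] at hγ
          rw [Finset.mem_erase, Finset.mem_filter]
          refine ⟨?_, hγ.1, ?_⟩
          · intro hγβ
            rw [hγβ] at hγ
            omega
          · omega
        have h1 := Finset.card_le_card hsub
        rw [Finset.card_erase_of_mem hmem] at h1
        have h2 : 0 < (B.filter (fun γ => (i : ℕ) ≤ γ)).card := Finset.card_pos.mpr ⟨β, hmem⟩
        simp only [List.length_cons] at hcard
        have hcard' : (B.filter (fun γ => (i : ℕ) + d ≤ γ)).card < t.length := by omega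
        rw [ih (fun p hp => hL p (List.mem_cons_of_mem _ hp)) ⟨(i : ℕ) + d, h⟩
          (by simpa using hcard'), mul_zero]
    · rfl

/-- (T1), chain form: with fewer boundaries than factors, every chain product of interval-rule
matrices vanishes, from every starting row. -/
theorem chain_eq_zero_of_card_lt (B : Finset ℕ) (L : List (ℕ × 𝕄))
    (hL : ∀ p ∈ L, IntervalRule B p.1 p.2) (hcard : B.card < L.length) (i : Fin (n + 2)) :
    chain L i = 0 :=
  chain_eq_zero_of_card_filter_lt B L hL i (lt_of_le_of_lt (Finset.card_filter_le _ _) hcard)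

/-- (T1), matrix form: a product of homogeneous interval-rule matrices (in any order) with fewer
boundaries than factors is the zero matrix.  Consequently every Lie polynomial in such matrices that
is a combination of full-length products vanishes: the depth-`k` bracket elements have zero
corner on every word-of-blocks structure with fewer than `k` blocks. -/
theorem listProd_eq_zero_of_card_lt (B : Finset ℕ) (L : List (ℕ × 𝕄))
    (hH : ∀ p ∈ L, Homog p.1 p.2) (hI : ∀ p ∈ L, IntervalRule B p.1 p.2)
    (hcard : B.card < L.length) : (L.map Prod.snd).prod = 0 := by
  ext i k
  rw [Matrix.zero_apply]
  by_cases hk : (k : ℕ) = i + (L.map Prod.fst).sum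
  · rw [listProd_apply L hH i k hk, chain_eq_zero_of_card_lt B L hI hcard i]
  · exact homog_listProd L hH i k hk

/-- (T1) for a bracket of two: fewer than two boundaries kill `⁅A, B⁆` when both factors are
homogeneous and satisfy the interval rule. -/
theorem lie_eq_zero_of_card_lt_two (B : Finset ℕ) {a b : ℕ} {A Y : 𝕄} (hA : Homog a A)
    (hY : Homog b Y) (hIA : IntervalRule B a A) (hIY : IntervalRule B b Y) (hcard : B.card < 2) :
    ⁅A, Y⁆ = 0 := by
  have h1 := listProd_eq_zero_of_card_lt B [(a, A), (b, Y)]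
    (by intro p hp; simp only [List.mem_cons, List.not_mem_nil, or_false] at hp
        rcases hp with rfl | rfl <;> assumption)
    (by intro p hp; simp only [List.mem_cons, List.not_mem_nil, or_false] at hp
        rcases hp with rfl | rfl <;> assumption)
    (by simpa using hcard)
  have h2 := listProd_eq_zero_of_card_lt B [(b, Y), (a, A)]
    (by intro p hp; simp only [List.mem_cons, List.not_mem_nil, or_false] at hp
        rcases hp with rfl | rfl <;> assumption)
    (by intro p hp; simp only [List.mem_cons, List.not_mem_nil, or_false] at hp
        rcases hp with rfl | rfl <;> assumption)
    (by simpa using hcard)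
  simp only [List.map_cons, List.map_nil, List.prod_cons, List.prod_nil, mul_one] at h1 h2
  rw [Ring.lie_def, h1, h2, sub_zero]

/-- (T1) for the two depth-three bracketings: fewer than three boundaries kill `⁅A, ⁅Y, Z⁆⁆` and
`⁅⁅A, Y⁆, Z⁆`. -/
theorem lie3_eq_zero_of_card_lt_three (B : Finset ℕ) {a b c : ℕ} {A Y Z : 𝕄} (hA : Homog a A)
    (hY : Homog b Y) (hZ : Homog c Z) (hIA : IntervalRule B a A) (hIY : IntervalRule B b Y)
    (hIZ : IntervalRule B c Z) (hcard : B.card < 3) :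
    ⁅A, ⁅Y, Z⁆⁆ = 0 ∧ ⁅⁅A, Y⁆, Z⁆ = 0 := by
  have key : ∀ (L : List (ℕ × 𝕄)), L.length = 3 → (∀ p ∈ L, p = (a, A) ∨ p = (b, Y) ∨ p = (c, Z)) →
      (L.map Prod.snd).prod = 0 := by
    intro L hlen hmem
    refine listProd_eq_zero_of_card_lt B L ?_ ?_ (by omega)
    · intro p hp
      rcases hmem p hp with rfl | rfl | rfl <;> assumption
    · intro p hp
      rcases hmem p hp with rfl | rfl | rfl <;> assumption
  have e : ∀ (P Q R : 𝕄) (p q r : ℕ),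
      ((p, P) = (a, A) ∨ (p, P) = (b, Y) ∨ (p, P) = (c, Z)) →
      ((q, Q) = (a, A) ∨ (q, Q) = (b, Y) ∨ (q, Q) = (c, Z)) →
      ((r, R) = (a, A) ∨ (r, R) = (b, Y) ∨ (r, R) = (c, Z)) → P * (Q * R) = 0 := by
    intro P Q R p q r hp hq hr
    have := key [(p, P), (q, Q), (r, R)] rfl (by
      intro x hx
      simp only [List.mem_cons, List.not_mem_nil, or_false] at hx
      rcases hx with rfl | rfl | rfl
      · exact hp
      · exact hq
      · exact hr)
    simpa [mul_assoc] using this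
  have hAm : (a, A) = (a, A) ∨ (a, A) = (b, Y) ∨ (a, A) = (c, Z) := Or.inl rfl
  have hYm : (b, Y) = (a, A) ∨ (b, Y) = (b, Y) ∨ (b, Y) = (c, Z) := Or.inr (Or.inl rfl)
  have hZm : (c, Z) = (a, A) ∨ (c, Z) = (b, Y) ∨ (c, Z) = (c, Z) := Or.inr (Or.inr rfl)
  constructor
  · rw [Ring.lie_def, Ring.lie_def, mul_sub, sub_mul, mul_assoc, mul_assoc,
      e A Y Z a b c hAm hYm hZm, e A Z Y a c b hAm hZm hYm, e Y Z A b c a hYm hZm hAm,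
      e Z Y A c b a hZm hYm hAm]
    simp
  · rw [Ring.lie_def, Ring.lie_def, sub_mul, mul_sub, mul_assoc, mul_assoc,
      e A Y Z a b c hAm hYm hZm, e Y A Z b a c hYm hAm hZm, e Z A Y c a b hZm hAm hYm,
      e Z Y A c b a hZm hYm hAm]
    simp


/-! ### Interlacing (the counting form of the compatibility condition (8.12.5))

If a chain of `k` interval-rule factors is nonzero and there are exactly `k` boundaries, then for
every `l` exactly `l` boundaries lie strictly below the `l`-th chain point: the chain points and the
boundaries interlace.  We prove the two inequalities separately. -/

/-- Splitting a chain product at a concatenation (when the first part fits in the matrix). -/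
theorem chain_append (L₁ L₂ : List (ℕ × 𝕄)) (i : Fin (n + 2))
    (h : (i : ℕ) + (L₁.map Prod.fst).sum < n + 2) :
    chain (L₁ ++ L₂) i = chain L₁ i * chain L₂ ⟨(i : ℕ) + (L₁.map Prod.fst).sum, h⟩ := by
  induction L₁ generalizing i with
  | nil =>
    have hi : (⟨(i : ℕ) + (([] : List (ℕ × 𝕄)).map Prod.fst).sum, h⟩ : Fin (n + 2)) = i :=
      Fin.ext (by simp)
    rw [hi]
    simp
  | cons p t ih =>
    obtain ⟨d, A⟩ := p
    simp only [List.map_cons, List.sum_cons] at h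
    have h' : (i : ℕ) + d < n + 2 := by omega
    have h'' : ((⟨(i : ℕ) + d, h'⟩ : Fin (n + 2)) : ℕ) + (t.map Prod.fst).sum < n + 2 := by
      simp only; omega
    rw [List.cons_append, chain_cons, chain_cons, dif_pos h', dif_pos h', ih ⟨(i : ℕ) + d, h'⟩ h'',
      mul_assoc]
    have hfin :
        (⟨((⟨(i : ℕ) + d, h'⟩ : Fin (n + 2)) : ℕ) + (t.map Prod.fst).sum, h''⟩ : Fin (n + 2)) =
          ⟨(i : ℕ) + (((d, A) :: t).map Prod.fst).sum, by simpa [add_assoc] using h⟩ :=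
      Fin.ext (by simp [add_assoc])
    rw [hfin]

/-- LOWER INTERLACING: along a nonzero chain of interval-rule factors, the first `l` intervals hold
at least `l` distinct boundaries, all below the `l`-th chain point. -/
theorem le_card_filter_of_chain_ne_zero (B : Finset ℕ) (L : List (ℕ × 𝕄))
    (hL : ∀ p ∈ L, IntervalRule B p.1 p.2) (i : Fin (n + 2)) (hne : chain L i ≠ 0)
    (l : ℕ) (hl : l ≤ L.length) :
    l ≤ (B.filter (fun β => (i : ℕ) ≤ β ∧ β < (i : ℕ) + ((L.take l).map Prod.fst).sum)).card := by
  induction L generalizing i l with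
  | nil =>
    simp only [List.length_nil, Nat.le_zero] at hl
    subst hl
    exact Nat.zero_le _
  | cons p t ih =>
    obtain ⟨d, Y⟩ := p
    rcases l with _ | l
    · exact Nat.zero_le _
    · simp only [List.length_cons, Nat.add_le_add_iff_right] at hl
      rw [chain_cons] at hne
      split_ifs at hne with h
      · have hY : Y i ⟨(i : ℕ) + d, h⟩ ≠ 0 := fun h0 => hne (by rw [h0, zero_mul])
        have ht : chain t ⟨(i : ℕ) + d, h⟩ ≠ 0 := fun h0 => hne (by rw [h0, mul_zero])
        obtain ⟨β, hβB, hiβ, hβj⟩ := hL (d, Y) List.mem_cons_self i ⟨(i : ℕ) + d, h⟩ rfl hY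
        have hβj' : β < (i : ℕ) + d := by simpa using hβj
        have ih' := ih (fun p hp => hL p (List.mem_cons_of_mem _ hp)) ⟨(i : ℕ) + d, h⟩ ht l hl
        simp only [List.take_succ_cons, List.map_cons, List.sum_cons]
        set S := ((t.take l).map Prod.fst).sum with hS
        have hsub : insert β (B.filter (fun γ => (i : ℕ) + d ≤ γ ∧ γ < (i : ℕ) + d + S)) ⊆
            B.filter (fun γ => (i : ℕ) ≤ γ ∧ γ < (i : ℕ) + (d + S)) := by
          intro γ hγ
          rw [Finset.mem_insert] at hγ
          rw [Finset.mem_filter]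
          rcases hγ with rfl | hγ
          · exact ⟨hβB, hiβ, by omega⟩
          · rw [Finset.mem_filter] at hγ
            exact ⟨hγ.1, by omega, by omega⟩
        have hnot : β ∉ B.filter (fun γ => (i : ℕ) + d ≤ γ ∧ γ < (i : ℕ) + d + S) := by
          intro hb
          rw [Finset.mem_filter] at hb
          omega
        have := Finset.card_le_card hsub
        rw [Finset.card_insert_of_notMem hnot] at this
        have ih'' : l ≤ (B.filter (fun γ => (i : ℕ) + d ≤ γ ∧ γ < (i : ℕ) + d + S)).card := by
          simpa using ih'
        omega
      · exact (hne rfl).elim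

/-- UPPER INTERLACING: along a nonzero chain of interval-rule factors that fits in the matrix, at
least `length - l` boundaries lie at or above the `l`-th chain point. -/
theorem length_sub_le_card_filter_of_chain_ne_zero (B : Finset ℕ) (L : List (ℕ × 𝕄))
    (hL : ∀ p ∈ L, IntervalRule B p.1 p.2) (i : Fin (n + 2))
    (hfit : (i : ℕ) + (L.map Prod.fst).sum < n + 2) (hne : chain L i ≠ 0) (l : ℕ) :
    L.length - l ≤ (B.filter (fun β => (i : ℕ) + ((L.take l).map Prod.fst).sum ≤ β)).card := by
  have hsplit := List.take_append_drop l L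
  have hsum : (L.map Prod.fst).sum =
      ((L.take l).map Prod.fst).sum + ((L.drop l).map Prod.fst).sum := by
    conv_lhs => rw [← hsplit]
    rw [List.map_append, List.sum_append]
  have h : (i : ℕ) + ((L.take l).map Prod.fst).sum < n + 2 := by omega
  have happ := chain_append (L.take l) (L.drop l) i h
  rw [hsplit] at happ
  have htail : chain (L.drop l) ⟨(i : ℕ) + ((L.take l).map Prod.fst).sum, h⟩ ≠ 0 :=
    fun h0 => hne (by rw [happ, h0, mul_zero])
  refine Nat.le_of_not_lt fun hlt => htail ?_
  apply chain_eq_zero_of_card_filter_lt B (L.drop l) (fun p hp => hL p (List.mem_of_mem_drop hp))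
  simpa [List.length_drop] using hlt

/-- INTERLACING (8.12.5): if a chain of `k` interval-rule factors starting at row `i` is nonzero,
fits in the matrix, there are exactly `k` boundaries and all of them are `≥ i`, then for every `l`
EXACTLY `l` boundaries lie strictly below the `l`-th chain point
`i + d₁ + ⋯ + d_l` — i.e. the chain points and the boundaries interlace:
`β_{l-1} < i + d₁ + ⋯ + d_l ≤ β_l`. -/
theorem card_filter_lt_chainPoint_eq (B : Finset ℕ) (L : List (ℕ × 𝕄))
    (hL : ∀ p ∈ L, IntervalRule B p.1 p.2) (i : Fin (n + 2)) (hB : ∀ β ∈ B, (i : ℕ) ≤ β)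
    (hcard : B.card = L.length) (hfit : (i : ℕ) + (L.map Prod.fst).sum < n + 2)
    (hne : chain L i ≠ 0) (l : ℕ) (hl : l ≤ L.length) :
    (B.filter (fun β => β < (i : ℕ) + ((L.take l).map Prod.fst).sum)).card = l := by
  set S := ((L.take l).map Prod.fst).sum with hS
  have hlow := le_card_filter_of_chain_ne_zero B L hL i hne l hl
  have hup := length_sub_le_card_filter_of_chain_ne_zero B L hL i hfit hne l
  rw [← hS] at hlow hup
  have heq : B.filter (fun β => (i : ℕ) ≤ β ∧ β < (i : ℕ) + S) =
      B.filter (fun β => β < (i : ℕ) + S) := by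
    ext β
    simp only [Finset.mem_filter]
    constructor
    · rintro ⟨hb, -, h2⟩; exact ⟨hb, h2⟩
    · rintro ⟨hb, h2⟩; exact ⟨hb, hB β hb, h2⟩
  rw [heq] at hlow
  have hpart := Finset.card_filter_add_card_filter_not (s := B) (fun β => β < (i : ℕ) + S)
  have hneg : B.filter (fun β => ¬ β < (i : ℕ) + S) = B.filter (fun β => (i : ℕ) + S ≤ β) := by
    ext β
    simp only [Finset.mem_filter, not_lt]
  rw [hneg] at hpart
  omega

end AllDepths

end SoloBlind

end Summit.KontsevichZagierPeriods.KontsevichZagierPeriods.Theorems
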